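import Mathlib

/-!
# T5CoverPreimage — the preimage of a subgroup in a split cover, and representations on which
the kernel acts by scalars

Tier-5 support for sub-step N3, row T2 (the `(χ_V, χ_W)`-splitting line), as made explicit in
route/T5-N3-route-2.md §N3.12.3: «`K̃ = s(K) × μ₂` with `μ₂` the kernel of the cover, acting on
`ω` by the genuine sign, so `K̃`-finite vectors = `s(K)`-finite vectors, `𝔤`- and `K̃`-invariant
subspaces of `𝒫` = `𝔤`- and `s(K)`-invariant subspaces, and the `(𝔤, K̃)`-modules on which `μ₂`
acts by the genuine sign are exactly the `(𝔤, K)`-modules through `s`».  The group-theoretic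
and linear-algebraic content of that line, kernel-checked for an abstract split cover
`p : G' →* G` with a homomorphic section `s` (`p ∘ s = id`):

* `mem_comap_iff_exists` / `section_mul_ker_injective` / `map_sup_ker_eq_comap`: every element
  of the preimage `K̃ = K.comap p` of a subgroup `K ≤ G` is uniquely `s k * z`, `k ∈ K`,
  `z ∈ ker p`, and `K̃ = s(K) ⊔ ker p`;
* `prodEquivComap`: when `ker p` is central (every cover in sight is central), `K × ker p ≃* K̃`;
* for a representation `ρ` of `G'` on which `ker p` acts by scalars `χ` (`hρ`): a submodule is
  `K̃`-stable iff it is `s(K)`-stable (`stable_comap_iff`, packaged as the order isomorphism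
  `subrepresentationOrderIso`), the `K̃`-orbit and the `s(K)`-orbit of a vector span the same
  submodule (`span_orbit_eq`), so `K̃`-finite vectors are exactly `s(K)`-finite vectors
  (`isFiniteVector_comap_iff`), and a linear map between two such representations is
  `K̃`-equivariant iff it is `s(K)`-equivariant (`intertwining_comap_iff`).

No topology and no Lie algebra: the `𝔤`-action of N3.12.3 is carried along unchanged by the
prose (it is the same operators on both sides).  Everything is proved (0 sorries); axioms ⊆
{propext, Classical.choice, Quot.sound}.
KEY-HYGIENE (README §8(d)): uses an L-value-free non-vanishing device: NO.
-/

namespace Summit.Ventures.HodgeRepro2.T5CoverPreimage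

/-! ## 1. The preimage of a subgroup under a split cover -/

section Groups

variable {G' G : Type*} [Group G'] [Group G] (p : G' →* G) (s : G →* G')

/-- `s(k) ∈ K.comap p` for `k ∈ K`. -/
theorem section_mem_comap (hs : ∀ g, p (s g) = g) {K : Subgroup G} {g : G} (hg : g ∈ K) :
    s g ∈ K.comap p := by
  rw [Subgroup.mem_comap, hs]; exact hg

/-- Every element of the preimage `K̃ = K.comap p` is `s k * z` with `k ∈ K` and `z ∈ ker p`. -/
theorem mem_comap_iff_exists (hs : ∀ g, p (s g) = g) (K : Subgroup G) (x : G') :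
    x ∈ K.comap p ↔ ∃ k ∈ K, ∃ z ∈ p.ker, x = s k * z := by
  constructor
  · intro hx
    refine ⟨p x, hx, (s (p x))⁻¹ * x, ?_, ?_⟩
    · rw [MonoidHom.mem_ker, map_mul, map_inv, hs, inv_mul_cancel]
    · rw [← mul_assoc, mul_inv_cancel, one_mul]
  · rintro ⟨k, hk, z, hz, rfl⟩
    rw [Subgroup.mem_comap, map_mul, hs, MonoidHom.mem_ker.mp hz, mul_one]
    exact hk

/-- The decomposition `x = s k * z` is unique: `k = p x` and `z = s (p x)⁻¹ * x`. -/
theorem section_mul_ker_injective (hs : ∀ g, p (s g) = g) {k₁ k₂ : G} {z₁ z₂ : G'}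
    (hz₁ : z₁ ∈ p.ker) (hz₂ : z₂ ∈ p.ker) (h : s k₁ * z₁ = s k₂ * z₂) : k₁ = k₂ ∧ z₁ = z₂ := by
  have hk : k₁ = k₂ := by
    have := congrArg p h
    rwa [map_mul, map_mul, hs, hs, MonoidHom.mem_ker.mp hz₁, MonoidHom.mem_ker.mp hz₂, mul_one,
      mul_one] at this
  subst hk
  exact ⟨rfl, mul_left_cancel h⟩

/-- `K̃ = s(K) ⊔ ker p`. -/
theorem map_sup_ker_eq_comap (hs : ∀ g, p (s g) = g) (K : Subgroup G) :
    K.map s ⊔ p.ker = K.comap p := by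
  apply le_antisymm
  · apply sup_le
    · rintro _ ⟨k, hk, rfl⟩
      exact section_mem_comap p s hs hk
    · intro z hz
      rw [Subgroup.mem_comap, MonoidHom.mem_ker.mp hz]
      exact K.one_mem
  · intro x hx
    obtain ⟨k, hk, z, hz, rfl⟩ := (mem_comap_iff_exists p s hs K x).mp hx
    exact Subgroup.mul_mem_sup ⟨k, hk, rfl⟩ hz

/-- The kernel of `p` meets `s(G)` trivially. -/
theorem section_mem_ker_iff (hs : ∀ g, p (s g) = g) (g : G) : s g ∈ p.ker ↔ g = 1 := by
  rw [MonoidHom.mem_ker, hs]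

/-- When `ker p` is central, `K × ker p ≃* K̃`, `(k, z) ↦ s k * z` (the internal direct
product `K̃ = s(K) × ker p` of N3.12.3). -/
def prodEquivComap (hs : ∀ g, p (s g) = g) (hZ : p.ker ≤ Subgroup.center G') (K : Subgroup G) :
    (K × p.ker) ≃* K.comap p where
  toFun x := ⟨s x.1 * x.2, (mem_comap_iff_exists p s hs K _).mpr ⟨x.1, x.1.2, x.2, x.2.2, rfl⟩⟩
  invFun x := (⟨p x, x.2⟩, ⟨(s (p x))⁻¹ * x, by
    rw [MonoidHom.mem_ker, map_mul, map_inv, hs, inv_mul_cancel]⟩)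
  left_inv x := by
    obtain ⟨⟨k, hk⟩, ⟨z, hz⟩⟩ := x
    have hpk : p (s k * z) = k := by
      rw [map_mul, hs, MonoidHom.mem_ker.mp hz, mul_one]
    ext
    · exact hpk
    · simp only [hpk, ← mul_assoc, inv_mul_cancel, one_mul]
  right_inv x := by
    ext
    simp only [← mul_assoc, mul_inv_cancel, one_mul]
  map_mul' x y := by
    obtain ⟨⟨k₁, hk₁⟩, ⟨z₁, hz₁⟩⟩ := x
    obtain ⟨⟨k₂, hk₂⟩, ⟨z₂, hz₂⟩⟩ := y
    ext
    simp only [Prod.mk_mul_mk, Subgroup.coe_mul, map_mul]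
    -- `z₁` is central: `s k₁ * z₁ * (s k₂ * z₂) = s k₁ * s k₂ * (z₁ * z₂)`
    have hc : z₁ * s k₂ = s k₂ * z₁ := (Subgroup.mem_center_iff.mp (hZ hz₁) (s k₂)).symm
    calc s k₁ * s k₂ * (z₁ * z₂) = s k₁ * (s k₂ * z₁) * z₂ := by simp only [mul_assoc]
      _ = s k₁ * (z₁ * s k₂) * z₂ := by rw [hc]
      _ = s k₁ * z₁ * (s k₂ * z₂) := by simp only [mul_assoc]

/-- The isomorphism `K × ker p ≃* K̃` sends `(k, z)` to `s k * z`. -/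
@[simp]
theorem prodEquivComap_apply_coe (hs : ∀ g, p (s g) = g) (hZ : p.ker ≤ Subgroup.center G')
    (K : Subgroup G) (x : K × p.ker) :
    ((prodEquivComap p s hs hZ K x : K.comap p) : G') = s x.1 * x.2 := rfl

end Groups

/-! ## 2. Representations on which the kernel acts by scalars -/

section Representations

variable {G' G : Type*} [Group G'] [Group G] (p : G' →* G) (s : G →* G')
variable {k V : Type*} [CommSemiring k] [AddCommMonoid V] [Module k V]
variable (ρ : Representation k G' V) (χ : G' → k)

/-- `ρ (s g * z) v = χ z • ρ (s g) v` when `ker p` acts by the scalars `χ`. -/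
theorem apply_section_mul (hρ : ∀ z ∈ p.ker, ∀ v : V, ρ z v = χ z • v) (g : G) {z : G'}
    (hz : z ∈ p.ker) (v : V) : ρ (s g * z) v = χ z • ρ (s g) v := by
  rw [map_mul, Module.End.mul_apply, hρ z hz, map_smul]

/-- A submodule is stable under the preimage `K̃ = K.comap p` iff it is stable under `s(K)`. -/
theorem stable_comap_iff (hs : ∀ g, p (s g) = g) (hρ : ∀ z ∈ p.ker, ∀ v : V, ρ z v = χ z • v)
    (K : Subgroup G) (W : Submodule k V) :
    (∀ x ∈ K.comap p, ∀ v ∈ W, ρ x v ∈ W) ↔ ∀ g ∈ K, ∀ v ∈ W, ρ (s g) v ∈ W := by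
  constructor
  · intro h g hg v hv
    exact h (s g) (section_mem_comap p s hs hg) v hv
  · intro h x hx v hv
    obtain ⟨g, hg, z, hz, rfl⟩ := (mem_comap_iff_exists p s hs K x).mp hx
    rw [apply_section_mul p s ρ χ hρ g hz]
    exact W.smul_mem _ (h g hg v hv)

/-- The subrepresentations of `ρ|_{K̃}` and of `(ρ ∘ s)|_K` are the same submodules:
an order isomorphism. -/
def subrepresentationOrderIso (hs : ∀ g, p (s g) = g)
    (hρ : ∀ z ∈ p.ker, ∀ v : V, ρ z v = χ z • v) (K : Subgroup G) :
    Subrepresentation (ρ.comp (K.comap p).subtype) ≃o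
      Subrepresentation ((ρ.comp s).comp K.subtype) where
  toFun W := ⟨W.toSubmodule, fun g v hv =>
    ((stable_comap_iff p s ρ χ hs hρ K W.toSubmodule).mp
      (fun x hx v hv => W.apply_mem_toSubmodule ⟨x, hx⟩ hv)) g g.2 v hv⟩
  invFun W := ⟨W.toSubmodule, fun x v hv =>
    ((stable_comap_iff p s ρ χ hs hρ K W.toSubmodule).mpr
      (fun g hg v hv => W.apply_mem_toSubmodule ⟨g, hg⟩ hv)) x x.2 v hv⟩
  left_inv W := by ext; rfl
  right_inv W := by ext; rfl
  map_rel_iff' := Iff.rfl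

/-- The `K̃`-orbit and the `s(K)`-orbit of a vector span the same submodule. -/
theorem span_orbit_eq (hs : ∀ g, p (s g) = g) (hρ : ∀ z ∈ p.ker, ∀ v : V, ρ z v = χ z • v)
    (K : Subgroup G) (v : V) :
    Submodule.span k ((fun x => ρ x v) '' (K.comap p : Set G')) =
      Submodule.span k ((fun g => ρ (s g) v) '' (K : Set G)) := by
  apply le_antisymm
  · rw [Submodule.span_le]
    rintro _ ⟨x, hx, rfl⟩
    obtain ⟨g, hg, z, hz, rfl⟩ := (mem_comap_iff_exists p s hs K x).mp hx
    show ρ (s g * z) v ∈ _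
    rw [apply_section_mul p s ρ χ hρ g hz]
    exact Submodule.smul_mem _ _ (Submodule.subset_span ⟨g, hg, rfl⟩)
  · rw [Submodule.span_le]
    rintro _ ⟨g, hg, rfl⟩
    exact Submodule.subset_span ⟨s g, section_mem_comap p s hs hg, rfl⟩

/-- `v` is an `S`-finite vector when the span of its `S`-orbit is a finite `k`-module. -/
def IsFiniteVector (S : Set G') (v : V) : Prop :=
  Module.Finite k (Submodule.span k ((fun x => ρ x v) '' S))

/-- `K̃`-finite vectors are exactly the `s(K)`-finite vectors. -/
theorem isFiniteVector_comap_iff (hs : ∀ g, p (s g) = g)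
    (hρ : ∀ z ∈ p.ker, ∀ v : V, ρ z v = χ z • v) (K : Subgroup G) (v : V) :
    IsFiniteVector ρ (K.comap p) v ↔
      Module.Finite k (Submodule.span k ((fun g => ρ (s g) v) '' (K : Set G))) := by
  unfold IsFiniteVector
  rw [span_orbit_eq p s ρ χ hs hρ K v]

/-- `K̃`-finite vectors are the `s(K)`-finite vectors of `ρ`, with `s(K)` as a subset of `G'`. -/
theorem isFiniteVector_comap_iff_map (hs : ∀ g, p (s g) = g)
    (hρ : ∀ z ∈ p.ker, ∀ v : V, ρ z v = χ z • v) (K : Subgroup G) (v : V) :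
    IsFiniteVector ρ (K.comap p) v ↔ IsFiniteVector ρ (K.map s) v := by
  rw [isFiniteVector_comap_iff p s ρ χ hs hρ K v]
  unfold IsFiniteVector
  have : (fun x => ρ x v) '' (K.map s : Set G') = (fun g => ρ (s g) v) '' (K : Set G) := by
    ext w
    constructor
    · rintro ⟨_, ⟨g, hg, rfl⟩, rfl⟩
      exact ⟨g, hg, rfl⟩
    · rintro ⟨g, hg, rfl⟩
      exact ⟨s g, ⟨g, hg, rfl⟩, rfl⟩
  rw [this]

variable {V₂ : Type*} [AddCommMonoid V₂] [Module k V₂] (ρ₂ : Representation k G' V₂)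

/-- A linear map between two representations on which `ker p` acts by the SAME scalars `χ`
is `K̃`-equivariant iff it is `s(K)`-equivariant. -/
theorem intertwining_comap_iff (hs : ∀ g, p (s g) = g)
    (hρ : ∀ z ∈ p.ker, ∀ v : V, ρ z v = χ z • v)
    (hρ₂ : ∀ z ∈ p.ker, ∀ v : V₂, ρ₂ z v = χ z • v) (K : Subgroup G) (f : V →ₗ[k] V₂) :
    (∀ x ∈ K.comap p, ∀ v, f (ρ x v) = ρ₂ x (f v)) ↔
      ∀ g ∈ K, ∀ v, f (ρ (s g) v) = ρ₂ (s g) (f v) := by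
  constructor
  · intro h g hg v
    exact h (s g) (section_mem_comap p s hs hg) v
  · intro h x hx v
    obtain ⟨g, hg, z, hz, rfl⟩ := (mem_comap_iff_exists p s hs K x).mp hx
    rw [apply_section_mul p s ρ χ hρ g hz, apply_section_mul p s ρ₂ χ hρ₂ g hz, map_smul,
      h g hg v]

/-- The same statement for the whole cover `G' = ⊤.comap p` and `s(G)`: a linear map is
`G'`-intertwining iff it intertwines the two representations `ρ ∘ s`, `ρ₂ ∘ s` of `G`
(Mathlib's `Representation.IsIntertwiningMap`). -/
theorem isIntertwiningMap_iff (hs : ∀ g, p (s g) = g)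
    (hρ : ∀ z ∈ p.ker, ∀ v : V, ρ z v = χ z • v)
    (hρ₂ : ∀ z ∈ p.ker, ∀ v : V₂, ρ₂ z v = χ z • v) (f : V →ₗ[k] V₂) :
    ρ.IsIntertwiningMap ρ₂ f ↔
      Representation.IsIntertwiningMap (ρ.comp s : Representation k G V)
        (ρ₂.comp s : Representation k G V₂) f := by
  have key := intertwining_comap_iff p s ρ χ ρ₂ hs hρ hρ₂ ⊤ f
  simp only [Subgroup.mem_top, true_implies] at key
  rw [Representation.isIntertwiningMap_iff, Representation.isIntertwiningMap_iff]
  constructor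
  · intro h g v
    exact h (s g) v
  · intro h x v
    exact key.mpr (fun g v => h g v) x (Subgroup.mem_comap.mpr trivial) v

end Representations

end Summit.Ventures.HodgeRepro2.T5CoverPreimage
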